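import Literature.Claims.NS.PanPan2025
import HarnessLib

/-!
# C97 `PanPan2025` (#103) — ERRATUM-COLUMN kernel refutation of `Step_IV2Abs` (the blow-up contradiction p.43 l.1–9)

`Literature.Claims.NS.PanPan2025.Step_IV2Abs` types, at the grain the print argues it (cell rule F15), the
inference of Ch. Ⅳ §4.2.2 p.43 l.1–9 «limsup_{t→T*} ‖∇u(t)‖_{L²} = +∞, meaning that for all ε > 0, there
exists δ > 0 such that ‖∇u(t)‖_{L²} > ε whenever T* − δ < t < T*. … Decomposing the dissipation integral
gives ν∫₀^{T*}‖∇u(s)‖²ds ≥ ν∫_{I_δ}‖∇u(s)‖²ds > ν·(2M/ν)·|I_δ| = 2Mδ … contradicting the global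
boundedness M in (44)»: a continuous nonnegative `g` on `[0,T)` that is unbounded near `T` would have
unbounded partial integrals `∫₀^τ g`, `τ < T`.  An unbounded integrand does not make an unbounded integral:
`T = 1`, `g(t) = (1 − t)^{−1/2}` is continuous and nonnegative on `[0,1)`, tends to `+∞` at `1`, and
`∫₀^τ g = 2(1 − (1−τ)^{1/2}) ≤ 2` for every `τ ∈ [0,1)` (witness bound `M = 2`).  This is the
load-bearing inference of the PRINTED route to `Step_IV` (`Step_IV` itself — `L^∞_t H¹_x` is a continuation
class — is true classically and is what `claim_of_steps` consumes); OFF the composition path; the verdict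
locator of record `Step_C1a` / token #103 / class / totals are untouched.  Refuter: ns-claims-refuter-1 g4;
filed under convention (b) by a salvage prover.

WHAT THIS IS NOT: not a claim about NS regularity or blow-up; not a claim about any author beyond the
typed locator.
-/

set_option linter.dupNamespace false

namespace Summit.NavierStokesRegularity.NavierStokesRegularity.Theorems.PanPan2025

open Literature.Claims.NS.PanPan2025 Set

/-- **p.43 l.1–9 fails at the printed grain**: `g(t) = (1 − t)^{−1/2}` on `[0,1)` is continuous, nonnegative
and unbounded, yet `∫₀^τ g ≤ 2` for all `τ < 1`. [cite: PanPan2025, Ch. Ⅳ §4.2.2 p.43 l.1–9] -/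
theorem not_Step_IV2Abs : ¬ Step_IV2Abs := by
  intro h
  have hcont : ContinuousOn (fun s : ℝ => (1 - s) ^ (-(1 / 2 : ℝ))) (Ico 0 1) := by
    apply ContinuousOn.rpow_const (continuousOn_const.sub continuousOn_id)
    intro x hx
    exact Or.inl (sub_pos.2 hx.2).ne'
  have hnn : ∀ t ∈ Ico (0 : ℝ) 1, 0 ≤ (1 - t) ^ (-(1 / 2 : ℝ)) :=
    fun t ht => Real.rpow_nonneg (sub_nonneg.2 ht.2.le) _
  have hunb : ∀ K : ℝ, ∃ t ∈ Ico (0 : ℝ) 1, K < (1 - t) ^ (-(1 / 2 : ℝ)) := by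
    intro K
    have hA : (1 : ℝ) ≤ |K| + 1 := by linarith [abs_nonneg K]
    set δ : ℝ := ((|K| + 1)⁻¹) ^ 2 with hδ
    have hδ0 : 0 < δ := by positivity
    have hδ1 : δ ≤ 1 := by
      rw [hδ]
      exact pow_le_one₀ (by positivity) (inv_le_one_of_one_le₀ hA)
    refine ⟨1 - δ, ⟨by linarith, by linarith⟩, ?_⟩
    rw [sub_sub_cancel, Real.rpow_neg hδ0.le, ← Real.sqrt_eq_rpow, hδ, Real.sqrt_sq (by positivity),
      inv_inv]
    linarith [le_abs_self K]
  obtain ⟨τ, hτ, hlt⟩ := h 1 one_pos _ hcont hnn hunb 2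
  -- ∫₀^τ (1 - s)^{-1/2} ds = ∫_{1-τ}^{1} x^{-1/2} dx = 2 (1 - (1 - τ)^{1/2}) ≤ 2
  have hsub : (∫ s in (0 : ℝ)..τ, (1 - s) ^ (-(1 / 2 : ℝ))) =
      ∫ x in (1 - τ)..(1 - 0), x ^ (-(1 / 2 : ℝ)) :=
    intervalIntegral.integral_comp_sub_left (fun x : ℝ => x ^ (-(1 / 2 : ℝ))) 1
  have hpow : 0 ≤ (1 - τ) ^ (-(1 / 2 : ℝ) + 1) := Real.rpow_nonneg (sub_nonneg.2 hτ.2.le) _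
  rw [hsub, integral_rpow (Or.inl (by norm_num))] at hlt
  norm_num at hlt hpow
  linarith

/-- FQN guard: the negated constant is the skeleton's decl. -/
example : ¬ Literature.Claims.NS.PanPan2025.Step_IV2Abs := not_Step_IV2Abs

end Summit.NavierStokesRegularity.NavierStokesRegularity.Theorems.PanPan2025
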